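import Mathlib.MeasureTheory.Measure.Lebesgue.VolumeOfBalls
import Mathlib.MeasureTheory.Integral.IntegralEqImproper
import Mathlib.Analysis.SpecialFunctions.Pow.Deriv
import Literature.Analysis.PDE.NewtonianKernel
import HarnessLib

/-!
# Route HardyPointSink — `HardyBalanceLaw`: the mass of the Newtonian bump in `ℝ³` is `4π`

Helper file for item stmt-NavierStokesRegularity-8388 (`HardyBalanceLaw`). The tree's
`Literature.Analysis.PDE.Newtonian.bumpMass E = ∫ n(n-2)(‖ξ‖² + 1)^{-(n+2)/2} dξ` is left
unevaluated there ("a value never needed"); the point-sink coefficient `4πν` of the Hardy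
balance law is exactly `ν · bumpMass ℝ³`, so here we compute **`bumpMass ℝ³ = 4π`**:
polar coordinates (`integral_fun_norm_addHaar`, `|B₁| = 4π/3`) reduce it to
`∫₀^∞ 3 y² (y² + 1)^{-5/2} dy = 1`, whose antiderivative is `y³ (y² + 1)^{-3/2}`.
-/

noncomputable section

open MeasureTheory Metric Set Filter Topology
open Literature.Analysis.PDE

set_option linter.dupNamespace false -- nested layout Summit.<S>.<Sub>, Sub = S (D-0017)

namespace Summit.NavierStokesRegularity.NavierStokesRegularity.Theorems

/-- `k = (n-2)/2 = 1/2` in `ℝ³`. -/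
theorem hardyPointSink_expo_fin_three : Newtonian.expo (EuclideanSpace ℝ (Fin 3)) = 1 / 2 := by
  unfold Newtonian.expo
  rw [finrank_euclideanSpace_fin]
  norm_num

/-- The radial antiderivative: `d/dy [y³ (y²+1)^{-3/2}] = 3 y² (y²+1)^{-5/2}`. -/
theorem hardyPointSink_hasDerivAt_radialPrimitive (y : ℝ) :
    HasDerivAt (fun y : ℝ => y ^ 3 * (y ^ 2 + 1) ^ (-3 / 2 : ℝ))
      (3 * y ^ 2 * (y ^ 2 + 1) ^ (-5 / 2 : ℝ)) y := by
  have hb : 0 < y ^ 2 + 1 := by positivity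
  have h1 : HasDerivAt (fun y : ℝ => y ^ 2 + 1) (2 * y) y := by
    simpa using ((hasDerivAt_pow 2 y).add_const (1 : ℝ))
  have h2 : HasDerivAt (fun y : ℝ => (y ^ 2 + 1) ^ (-3 / 2 : ℝ))
      (2 * y * (-3 / 2 : ℝ) * (y ^ 2 + 1) ^ ((-3 / 2 : ℝ) - 1)) y :=
    h1.rpow_const (Or.inl hb.ne')
  have h3 : HasDerivAt (fun y : ℝ => y ^ 3) (3 * y ^ 2) y := by
    simpa using hasDerivAt_pow 3 y
  have h4 := h3.fun_mul h2
  refine h4.congr_deriv ?_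
  have e1 : (y ^ 2 + 1) ^ (-3 / 2 : ℝ) = (y ^ 2 + 1) ^ (-5 / 2 : ℝ) * (y ^ 2 + 1) := by
    rw [show (-3 / 2 : ℝ) = (-5 / 2 : ℝ) + 1 by norm_num, Real.rpow_add_one hb.ne']
  have e2 : (y ^ 2 + 1) ^ ((-3 / 2 : ℝ) - 1) = (y ^ 2 + 1) ^ (-5 / 2 : ℝ) := by
    norm_num
  rw [e1, e2]
  ring

/-- For `y > 0`, `y³ (y²+1)^{-3/2} = (1 + (y²)⁻¹)^{-3/2}`. -/
theorem hardyPointSink_radialPrimitive_eq {y : ℝ} (hy : 0 < y) :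
    y ^ 3 * (y ^ 2 + 1) ^ (-3 / 2 : ℝ) = (1 + (y ^ 2)⁻¹) ^ (-3 / 2 : ℝ) := by
  have hy2 : 0 < y ^ 2 := by positivity
  have e1 : (1 + (y ^ 2)⁻¹ : ℝ) = (y ^ 2 + 1) * (y ^ 2)⁻¹ := by
    field_simp
  have e2 : ((y ^ 2)⁻¹ : ℝ) ^ (-3 / 2 : ℝ) = y ^ 3 := by
    rw [← Real.rpow_natCast y 2, ← Real.rpow_neg hy.le, ← Real.rpow_mul hy.le,
      ← Real.rpow_natCast y 3]
    norm_num
  rw [e1, Real.mul_rpow (by positivity) (by positivity), e2]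
  ring

/-- `y³ (y²+1)^{-3/2} → 1` as `y → ∞`. -/
theorem hardyPointSink_tendsto_radialPrimitive :
    Tendsto (fun y : ℝ => y ^ 3 * (y ^ 2 + 1) ^ (-3 / 2 : ℝ)) atTop (𝓝 1) := by
  have h1 : Tendsto (fun y : ℝ => (1 + (y ^ 2)⁻¹) ^ (-3 / 2 : ℝ)) atTop (𝓝 1) := by
    have h0 : Tendsto (fun y : ℝ => (y ^ 2)⁻¹) atTop (𝓝 0) :=
      tendsto_inv_atTop_zero.comp (tendsto_pow_atTop two_ne_zero)
    have h2 : Tendsto (fun y : ℝ => 1 + (y ^ 2)⁻¹) atTop (𝓝 1) := by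
      simpa using h0.const_add 1
    have := h2.rpow_const (p := (-3 / 2 : ℝ)) (Or.inl one_ne_zero)
    simpa using this
  refine h1.congr' ?_
  filter_upwards [eventually_gt_atTop 0] with y hy
  exact (hardyPointSink_radialPrimitive_eq hy).symm

/-- **The radial integral**: `∫₀^∞ 3 y² (y²+1)^{-5/2} dy = 1`. -/
theorem hardyPointSink_integral_radial :
    ∫ y in Ioi (0 : ℝ), 3 * y ^ 2 * (y ^ 2 + 1) ^ (-5 / 2 : ℝ) = 1 := by
  have hcont : ContinuousWithinAt (fun y : ℝ => y ^ 3 * (y ^ 2 + 1) ^ (-3 / 2 : ℝ)) (Ici 0) 0 :=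
    (hardyPointSink_hasDerivAt_radialPrimitive 0).continuousAt.continuousWithinAt
  have hint : IntegrableOn (fun y : ℝ => 3 * y ^ 2 * (y ^ 2 + 1) ^ (-5 / 2 : ℝ)) (Ioi 0) :=
    integrableOn_Ioi_deriv_of_nonneg hcont
      (fun y _ => hardyPointSink_hasDerivAt_radialPrimitive y)
      (fun y _ => by positivity) hardyPointSink_tendsto_radialPrimitive
  rw [integral_Ioi_of_hasDerivAt_of_tendsto hcont
    (fun y _ => hardyPointSink_hasDerivAt_radialPrimitive y) hint
    hardyPointSink_tendsto_radialPrimitive]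
  norm_num

/-- The unit Newtonian bump of `ℝ³` is the radial profile `3 (‖ξ‖²+1)^{-5/2}`. -/
theorem hardyPointSink_regBump_one_eq (ξ : EuclideanSpace ℝ (Fin 3)) :
    Newtonian.regBump 1 ξ = 3 * (‖ξ‖ ^ 2 + 1) ^ (-5 / 2 : ℝ) := by
  unfold Newtonian.regBump
  rw [hardyPointSink_expo_fin_three, finrank_euclideanSpace_fin]
  norm_num

/-- **`bumpMass ℝ³ = 4π`**: the mass `∫ 3(‖ξ‖²+1)^{-5/2} dξ` of the unit Newtonian bump of
`ℝ³` (equivalently `(n-2)|S^{n-1}| = 4π` for `n = 3`). -/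
theorem hardyPointSink_bumpMass_fin_three :
    Newtonian.bumpMass (EuclideanSpace ℝ (Fin 3)) = 4 * Real.pi := by
  unfold Newtonian.bumpMass
  have e : (Newtonian.regBump 1 : EuclideanSpace ℝ (Fin 3) → ℝ) =
      fun ξ => (fun y : ℝ => 3 * (y ^ 2 + 1) ^ (-5 / 2 : ℝ)) ‖ξ‖ :=
    funext hardyPointSink_regBump_one_eq
  rw [e, integral_fun_norm_addHaar (volume : Measure (EuclideanSpace ℝ (Fin 3)))
    (fun y : ℝ => 3 * (y ^ 2 + 1) ^ (-5 / 2 : ℝ)), finrank_euclideanSpace_fin]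
  have hrad : ∫ y in Ioi (0 : ℝ), y ^ (3 - 1) • (3 * (y ^ 2 + 1) ^ (-5 / 2 : ℝ)) = 1 := by
    calc ∫ y in Ioi (0 : ℝ), y ^ (3 - 1) • (3 * (y ^ 2 + 1) ^ (-5 / 2 : ℝ))
        = ∫ y in Ioi (0 : ℝ), 3 * y ^ 2 * (y ^ 2 + 1) ^ (-5 / 2 : ℝ) := by
          refine setIntegral_congr_fun measurableSet_Ioi fun y _ => ?_
          simp only [smul_eq_mul]
          ring
      _ = 1 := hardyPointSink_integral_radial
  rw [hrad, measureReal_def, EuclideanSpace.volume_ball_fin_three, ENNReal.toReal_mul,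
    ENNReal.ofReal_one, one_pow, ENNReal.toReal_one,
    ENNReal.toReal_ofReal (by positivity : (0 : ℝ) ≤ Real.pi * 4 / 3)]
  simp only [nsmul_eq_mul, smul_eq_mul]
  ring

end Summit.NavierStokesRegularity.NavierStokesRegularity.Theorems

end
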